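import Literature.NumberTheory.EllipticCurves.PeterssonNormLowerBound
import Literature.NumberTheory.EllipticCurves.ModularDegreeFormulaDomainProofs
import Literature.NumberTheory.Sieve.QuadraticRootsPrimeModuliDFIGamma0Domain
import Mathlib.Analysis.Convex.Integral
import HarnessLib

/-!
# The Siegel strip of height `1/N` injects into `Γ₀(N)∖ℍ` — level-sharpened lower bounds for the
# Petersson norm (proofs)

Proofs-only sibling of `Literature/NumberTheory/EllipticCurves/PeterssonNormLowerBound.lean`
(named fact `HoffsteinLockhart1994_peterssonProduct_lower_bound`: `(f, f)_{Γ₀(N)} ≫_ε N^{1-ε}` for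
the newform of an elliptic curve over `ℚ`) and of
`Literature/NumberTheory/EllipticCurves/NewformPeterssonSizeProofs.lean`, which is the home of
Pasten's trivial bound over the box `{|x| ≤ 1/2, y > 1} ⊆ 𝒟` (height `Y = 1`:
`normSq_cuspCoeff_mul_le_peterssonProduct_re`, `peterssonProduct_re_ge_of_isNormalized`,
`IsNewformOf.peterssonProduct_re_ge/pos`), of the range `ε ≥ 1` of the fact
(`HoffsteinLockhart1994_peterssonProduct_lower_bound_of_one_le`) and of the constant-form /
log-form equivalence (`…_iff_log`). **This file adds the level-sharpened strip only**: the strip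
`{0 < x < 1, y > Y}` with `N Y ≥ 1` is no longer inside `𝒟`, but it still injects into `Γ₀(N)∖ℍ`,
which is what the elementary `N^{1/2-ε}` bound (sibling `PeterssonNormLowerBoundSqrtProofs.lean`)
needs (`Y = 1/N`, so that the coefficients `a_{p²}`, `p² ≤ N`, are not exponentially damped).
No definitions, no named facts.

* `SL2Z_eq_one_or_neg_one_of_smul_mem_strip` — **strip rigidity**: if `N Y ≥ 1`, `g ∈ Γ₀(N)` and
  both `z`, `g z` lie in `{0 < re < 1, im > Y}`, then `g = ±1` (for `c ≠ 0`, `|c| ≥ N` gives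
  `im g z ≤ 1/(c² im z) < 1/(N² Y) ≤ Y`; for `c = 0`, `g = ±Tⁿ` with `n = 0`);
  `tsum_indicator_strip_le_two` — hence every orbit meets the strip in at most the two group
  elements `±γ`.
* `lintegral_strip_le_peterssonProduct` — for `f ∈ S₂(Γ₀(N))`:
  `∫_{strip} |f|² y² dμ ≤ (f, f)_{Γ₀(N)}`, by unfolding (`DFI1995.setLIntegral_le_of_invariant`
  over the fundamental domain `⋃_q g_q⁻¹ 𝒟` of `DFI1995.isHypFundamentalDomain_gamma0Domain`,
  matched with the tree's expression of `(f, f)` as `∫_{⋃ g_q⁻¹ 𝒟ᵒ} |f|² y² dμ`,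
  `peterssonProduct_self_eq_lintegral`; the two domains differ by a null set:
  `isRightTransversal_image_inv`, `gamma0Domain_subset_iUnion_union`).
* `norm_cuspCoeff_sq_mul_le_peterssonProduct` — **`|aₙ(f)|² e^{-4πnY}/(4πn) ≤ (f, f)`** for
  `n ≥ 1`, `N Y ≥ 1` (change of variables `dμ = dx dy / y²`, Tonelli on `(0,1) × (Y, ∞)`, the
  line bound `|aₙ|² e^{-4πny} ≤ ∫₀¹ |f(x+iy)|² dx` (Cauchy–Schwarz/Jensen), and
  `∫_Y^∞ e^{-4πny} dy = e^{-4πnY}/(4πn)`); at `Y = 1/N`: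
  `norm_cuspCoeff_sq_mul_le_peterssonProduct_level`, and for normalised `f`
  `e^{-4π/N}/(4π) ≤ (f, f)` (`exp_div_le_peterssonProduct_of_isNormalized`,
  `IsNewformOf.exp_div_le_peterssonProduct`).
* (This file does not import `NewformPeterssonSizeProofs.lean`; the one overlapping step, the
  line bound `|aₙ|² e^{-4πny} ≤ ∫₀¹ |f(x+iy)|² dx` = that file's
  `normSq_cuspCoeff_mul_exp_le_intervalIntegral`, is restated privately in the `ofComplex` form
  used here. The reductions of both facts to `0 < ε ≤ 1/2` live in the `Sqrt` sibling.)

## What is NOT here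

The range `0 < ε < 1`, i.e. the theorem of Hoffstein–Lockhart itself (`L(1, sym² f) ≫_ε N^{-ε}`,
GL(3) theory absent from Mathlib and Literature); the elementary range `1/2 < ε < 1` (Iwaniec,
*Spectral methods of automorphic forms*, Thm. 8.3: `|λ(p)| ≥ 1/2` or `|λ(p²)| ≥ 1/2`) is the
sibling `PeterssonNormLowerBoundSqrtProofs.lean`, built on this file.

## References

* H. Pasten, *Shimura curves and the abc conjecture*, J. Number Theory 254 (2024), §3 (the norm
  `‖f‖²_{2,Γ₀(N)} = ∫ |f|² y² dμ_𝔥` and the trivial lower bound). [cite: PastenShimura2024, §3]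
* H. Iwaniec, *Spectral Methods of Automorphic Forms*, GSM 53 (2002), §2.2–2.4 (fundamental
  domains, unfolding), §8.5 Thm. 8.3. [cite: Iwaniec2002, Thm. 8.3]
* J. Hoffstein, P. Lockhart, Ann. of Math. 140 (1994), 161–181. [cite: HoffsteinLockhart1994, Thm. 0.1]
-/

noncomputable section
open scoped MatrixGroups ModularForm Modular Topology ENNReal NNReal
open MeasureTheory Filter Set Function ModularGroup CongruenceSubgroup
open UpperHalfPlane hiding I

namespace Literature.NumberTheory.EllipticCurves.ModularForms

/-! ### Strip rigidity for `Γ₀(N)` -/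

section Strip

/-- An element of `SL(2, ℤ)` acting trivially on `ℍ` is `±1`. [folklore] -/
theorem SL2Z_eq_one_or_neg_one_of_forall_smul_eq (g : SL(2, ℤ)) (h : ∀ z : ℍ, g • z = z) :
    g = 1 ∨ g = -1 := by
  have hI2 : (⟨2 * Complex.I, by simp⟩ : ℍ) ≠ UpperHalfPlane.I := by
    intro h'
    have := congrArg UpperHalfPlane.im h'
    simp [UpperHalfPlane.im, UpperHalfPlane.I] at this
  have hmem : (g : GL (Fin 2) ℝ) ∈
      (Matrix.SpecialLinearGroup.toGL : SL(2, ℝ) →* GL (Fin 2) ℝ).range := ⟨_, rfl⟩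
  have hneg : Matrix.SpecialLinearGroup.mapGL ℝ (-1 : SL(2, ℤ)) = (-1 : GL (Fin 2) ℝ) := by
    ext i j
    fin_cases i <;> fin_cases j <;>
      simp [Matrix.SpecialLinearGroup.mapGL, Matrix.SpecialLinearGroup.toGL]
  rcases Automorphic.eq_one_or_neg_one_of_fixed_two hmem hI2 (h _) (h _) with h1 | h1
  · left
    apply Matrix.SpecialLinearGroup.mapGL_injective (R := ℤ) (S := ℝ)
    rw [map_one]
    exact h1
  · right
    apply Matrix.SpecialLinearGroup.mapGL_injective (R := ℤ) (S := ℝ)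
    rw [hneg]
    exact h1

/-- **Strip rigidity for `Γ₀(N)`.** If `N Y ≥ 1` and both `z` and `g z` (`g ∈ Γ₀(N)`) lie in the
half-open strip `{0 < re < 1, im > Y}`, then `g = ±1`: for `c ≠ 0` one has `|c| ≥ N`, so
`im (g z) = im z / |cz + d|² ≤ 1/(c² im z) < 1/(N² Y) ≤ Y`; for `c = 0`, `g = ±Tⁿ` shifts the real
part by `n`, forcing `n = 0` (the standard injectivity of the Siegel strip of height `1/N` into
`Γ₀(N)∖ℍ`; cf. Iwaniec 2002, §2.2–2.4). [folklore] -/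
theorem SL2Z_eq_one_or_neg_one_of_smul_mem_strip {N : ℕ} {Y : ℝ} (hNY : 1 ≤ N * Y)
    {g : SL(2, ℤ)} (hg : g ∈ Gamma0 N) {z : ℍ}
    (hz : 0 < z.re ∧ z.re < 1 ∧ Y < z.im) (hgz : 0 < (g • z).re ∧ (g • z).re < 1 ∧ Y < (g • z).im) :
    g = 1 ∨ g = -1 := by
  have hY : 0 < Y := by
    by_contra hY
    rw [not_lt] at hY
    have : (N : ℝ) * Y ≤ 0 := mul_nonpos_of_nonneg_of_nonpos (Nat.cast_nonneg N) hY
    linarith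
  by_cases hc : g 1 0 = 0
  · obtain ⟨n, hn⟩ := ModularGroup.exists_eq_T_zpow_of_c_eq_zero hc
    have hre : (g • z).re = z.re + n := by rw [hn z, re_T_zpow_smul]
    have hn0 : n = 0 := by
      have h1 : (-1 : ℝ) < n := by linarith [hz.1, hz.2.1, hgz.1, hgz.2.1]
      have h2 : (n : ℝ) < 1 := by linarith [hz.1, hz.2.1, hgz.1, hgz.2.1]
      have h1' : (-1 : ℤ) < n := by exact_mod_cast h1
      have h2' : n < 1 := by exact_mod_cast h2
      omega
    subst hn0
    exact SL2Z_eq_one_or_neg_one_of_forall_smul_eq g fun w ↦ by rw [hn w, zpow_zero, one_smul]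
  · exfalso
    -- `N ∣ c`, so `N ≤ |c|`
    have hdvd : (N : ℤ) ∣ g 1 0 := by
      rw [Gamma0_mem] at hg
      exact (ZMod.intCast_zmod_eq_zero_iff_dvd _ _).mp hg
    have hNc : (N : ℝ) ≤ |((g 1 0 : ℤ) : ℝ)| := by
      have := Int.le_of_dvd (abs_pos.mpr hc) ((dvd_abs _ _).mpr hdvd)
      rw [← Int.cast_abs]
      exact_mod_cast this
    have hN : (0 : ℝ) < N := by
      rcases Nat.eq_zero_or_pos N with h0 | h0
      · subst h0; simp at hNY; linarith
      · exact_mod_cast h0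
    -- `im (g z) ≤ 1 / (c² im z)`
    have him : (g • z).im = z.im / Complex.normSq (denom g z) := ModularGroup.im_smul_eq_div_normSq g z
    have hden : (((g 1 0 : ℤ) : ℝ) * z.im) ^ 2 ≤ Complex.normSq (denom g z) := by
      have := z.c_mul_im_sq_le_normSq_denom g
      simpa using this
    have hzim : 0 < z.im := z.im_pos
    have hcpos : 0 < |((g 1 0 : ℤ) : ℝ)| := lt_of_lt_of_le hN hNc
    have hc2 : (N : ℝ) ^ 2 ≤ ((g 1 0 : ℤ) : ℝ) ^ 2 := by
      rw [← sq_abs (((g 1 0 : ℤ) : ℝ))]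
      exact pow_le_pow_left₀ hN.le hNc 2
    have hnormpos : 0 < Complex.normSq (denom g z) := by
      have : 0 < (((g 1 0 : ℤ) : ℝ) * z.im) ^ 2 := by positivity
      linarith
    -- `Y < im (g z) = im z / normSq ≤ im z / (c z.im)² = 1/(c² im z)`
    have h1 : Y < z.im / (((g 1 0 : ℤ) : ℝ) * z.im) ^ 2 := by
      calc Y < (g • z).im := hgz.2.2
        _ = z.im / Complex.normSq (denom g z) := him
        _ ≤ z.im / (((g 1 0 : ℤ) : ℝ) * z.im) ^ 2 :=
            div_le_div_of_nonneg_left hzim.le (by positivity) hden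
    have h2 : z.im / (((g 1 0 : ℤ) : ℝ) * z.im) ^ 2 = 1 / (((g 1 0 : ℤ) : ℝ) ^ 2 * z.im) := by
      field_simp
    rw [h2] at h1
    -- so `Y c² im z < 1`, but `c² ≥ N²`, `im z > Y`, `N Y ≥ 1`
    have h3 : Y * (((g 1 0 : ℤ) : ℝ) ^ 2 * z.im) < 1 := by
      have hpos : 0 < ((g 1 0 : ℤ) : ℝ) ^ 2 * z.im := by positivity
      exact (lt_div_iff₀ hpos).mp h1
    have h4 : (N : ℝ) ^ 2 * Y ≤ ((g 1 0 : ℤ) : ℝ) ^ 2 * z.im := by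
      calc (N : ℝ) ^ 2 * Y ≤ ((g 1 0 : ℤ) : ℝ) ^ 2 * Y := by gcongr
        _ ≤ ((g 1 0 : ℤ) : ℝ) ^ 2 * z.im := by gcongr; exact hz.2.2.le
    have h5 : Y * ((N : ℝ) ^ 2 * Y) < 1 := lt_of_le_of_lt (by gcongr) h3
    have h6 : (1 : ℝ) ≤ ((N : ℝ) * Y) ^ 2 := by nlinarith
    nlinarith


/-- **Strip multiplicity.** For `N Y ≥ 1`, every `Γ₀(N)`-orbit meets the strip
`{0 < re < 1, im > Y}` in at most two group elements `±γ` (counted in `Γ₀(N) ≤ GL(2, ℝ)`):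
the multiplicity hypothesis of `DFI1995.setLIntegral_le_of_invariant` with `M = 2`. [folklore] -/
theorem tsum_indicator_strip_le_two {N : ℕ} {Y : ℝ} (hNY : 1 ≤ N * Y) (w : ℍ) :
    ∑' γ : ↥(Gamma0 N : Subgroup (GL (Fin 2) ℝ)),
      {τ : ℍ | 0 < τ.re ∧ τ.re < 1 ∧ Y < τ.im}.indicator (1 : ℍ → ℝ≥0∞)
        ((γ : GL (Fin 2) ℝ) • w) ≤ 2 := by
  classical
  set K : Set ℍ := {τ : ℍ | 0 < τ.re ∧ τ.re < 1 ∧ Y < τ.im} with hK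
  by_cases hex : ∃ γ₁ : ↥(Gamma0 N : Subgroup (GL (Fin 2) ℝ)), (γ₁ : GL (Fin 2) ℝ) • w ∈ K
  · obtain ⟨γ₁, hγ₁⟩ := hex
    have hneg : -(γ₁ : GL (Fin 2) ℝ) ∈ (Gamma0 N : Subgroup (GL (Fin 2) ℝ)) := by
      rw [← neg_one_mul]
      exact mul_mem Literature.NumberTheory.Sieve.DFI1995.neg_one_mem_Gamma0GL γ₁.2
    set γ₂ : ↥(Gamma0 N : Subgroup (GL (Fin 2) ℝ)) := ⟨-(γ₁ : GL (Fin 2) ℝ), hneg⟩ with hγ₂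
    have hsupp : ∀ γ : ↥(Gamma0 N : Subgroup (GL (Fin 2) ℝ)), γ ∉ ({γ₁, γ₂} : Finset _) →
        K.indicator (1 : ℍ → ℝ≥0∞) ((γ : GL (Fin 2) ℝ) • w) = 0 := by
      intro γ hγ
      apply Set.indicator_of_notMem
      intro hγw
      apply hγ
      obtain ⟨g, hg, hgeq⟩ := Literature.NumberTheory.Sieve.DFI1995.mem_Gamma0GL_iff.1
        (mul_mem γ.2 (inv_mem γ₁.2) :
          (γ : GL (Fin 2) ℝ) * (γ₁ : GL (Fin 2) ℝ)⁻¹ ∈ (Gamma0 N : Subgroup (GL (Fin 2) ℝ)))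
      have hz : g • ((γ₁ : GL (Fin 2) ℝ) • w) = (γ : GL (Fin 2) ℝ) • w := by
        rw [ModularGroup.sl_moeb, ← mul_smul]
        change (Matrix.SpecialLinearGroup.mapGL ℝ g * (γ₁ : GL (Fin 2) ℝ)) • w = _
        rw [hgeq, inv_mul_cancel_right]
      have hγw' : 0 < (g • ((γ₁ : GL (Fin 2) ℝ) • w)).re ∧ (g • ((γ₁ : GL (Fin 2) ℝ) • w)).re < 1 ∧
          Y < (g • ((γ₁ : GL (Fin 2) ℝ) • w)).im := by
        rw [hz]; exact hγw
      rcases SL2Z_eq_one_or_neg_one_of_smul_mem_strip hNY hg hγ₁ hγw' with h1 | h1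
      · subst h1
        rw [map_one] at hgeq
        have : (γ : GL (Fin 2) ℝ) = γ₁ := mul_inv_eq_one.mp hgeq.symm
        rw [Finset.mem_insert]
        exact Or.inl (Subtype.ext this)
      · subst h1
        have hneg1 : Matrix.SpecialLinearGroup.mapGL ℝ (-1 : SL(2, ℤ)) = (-1 : GL (Fin 2) ℝ) := by
          ext i j
          fin_cases i <;> fin_cases j <;>
            simp [Matrix.SpecialLinearGroup.mapGL, Matrix.SpecialLinearGroup.toGL]
        rw [hneg1] at hgeq
        have : (γ : GL (Fin 2) ℝ) = -γ₁ := by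
          rw [← neg_one_mul (γ₁ : GL (Fin 2) ℝ)]
          exact mul_inv_eq_iff_eq_mul.mp hgeq.symm
        rw [Finset.mem_insert, Finset.mem_singleton]
        exact Or.inr (Subtype.ext this)
    rw [tsum_eq_sum (s := ({γ₁, γ₂} : Finset _)) fun γ hγ ↦ hsupp γ hγ]
    calc ∑ γ ∈ ({γ₁, γ₂} : Finset _), K.indicator (1 : ℍ → ℝ≥0∞) ((γ : GL (Fin 2) ℝ) • w)
        ≤ ∑ γ ∈ ({γ₁, γ₂} : Finset _), (1 : ℝ≥0∞) :=
          Finset.sum_le_sum fun γ _ ↦ Set.indicator_apply_le' (fun _ ↦ le_rfl) (fun _ ↦ zero_le)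
      _ = (({γ₁, γ₂} : Finset _).card : ℝ≥0∞) := by simp
      _ ≤ 2 := by exact_mod_cast Finset.card_le_two
  · simp only [not_exists] at hex
    have : ∀ γ : ↥(Gamma0 N : Subgroup (GL (Fin 2) ℝ)),
        K.indicator (1 : ℍ → ℝ≥0∞) ((γ : GL (Fin 2) ℝ) • w) = 0 :=
      fun γ ↦ Set.indicator_of_notMem (hex γ) _
    rw [ENNReal.tsum_eq_zero.2 this]
    exact zero_le

end Strip

/-! ### The strip integral is bounded by the Petersson norm -/

section StripBound

variable {N : ℕ} (g : (↥𝒮ℒ ⧸ (Gamma0 N : Subgroup (GL (Fin 2) ℝ)).subgroupOf 𝒮ℒ) → SL(2, ℤ))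
  (hg : ∀ q, (Matrix.SpecialLinearGroup.mapGL ℝ (g q) : GL (Fin 2) ℝ) = ((q.out : ↥𝒮ℒ) : GL (Fin 2) ℝ))

include hg in
/-- The inverses `{g_q⁻¹}` of a system of representatives `g_q` of the left cosets `𝒮ℒ/Γ₀(N)`
form a right transversal of `Γ₀(N)` in `SL(2, ℤ)` in the sense of `DFI1995.IsRightTransversal`.
[folklore] -/
theorem isRightTransversal_image_inv
    [Fintype (↥𝒮ℒ ⧸ (Gamma0 N : Subgroup (GL (Fin 2) ℝ)).subgroupOf 𝒮ℒ)] :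
    Literature.NumberTheory.Sieve.DFI1995.IsRightTransversal N
      (Finset.univ.image fun q ↦ (g q)⁻¹) := by
  classical
  intro s
  set q₀ : (↥𝒮ℒ ⧸ (Gamma0 N : Subgroup (GL (Fin 2) ℝ)).subgroupOf 𝒮ℒ) :=
    QuotientGroup.mk (⟨Matrix.SpecialLinearGroup.mapGL ℝ s⁻¹, s⁻¹, rfl⟩ : ↥𝒮ℒ) with hq₀
  have hmem₀ : s * g q₀ ∈ Gamma0 N := by
    have h := inv_mul_mem_Gamma0_of_mk g hg s⁻¹
    have : s * g q₀ = ((g q₀)⁻¹ * s⁻¹)⁻¹ := by group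
    rw [this]
    exact inv_mem h
  refine ⟨(g q₀)⁻¹, ⟨Finset.mem_image_of_mem _ (Finset.mem_univ _), by rwa [inv_inv]⟩, ?_⟩
  rintro t ⟨ht, hst⟩
  obtain ⟨q, -, rfl⟩ := Finset.mem_image.mp ht
  rw [inv_inv] at hst
  have hq : q = q₀ := by
    rw [coset_eq_iff g hg]
    have : (g q)⁻¹ * g q₀ = (s * g q)⁻¹ * (s * g q₀) := by group
    rw [this]
    exact mul_mem (inv_mem hst) hmem₀
  rw [hq]

/-- The closed-domain version `⋃_q g_q⁻¹ 𝒟` (`DFI1995.gamma0Domain`) of the tree's open domain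
`⋃_q g_q⁻¹ 𝒟ᵒ` exceeds it only by points with an `SL(2, ℤ)`-translate on the null boundary
`𝒟 ∖ 𝒟ᵒ`. [folklore] -/
theorem gamma0Domain_subset_iUnion_union
    [Fintype (↥𝒮ℒ ⧸ (Gamma0 N : Subgroup (GL (Fin 2) ℝ)).subgroupOf 𝒮ℒ)] :
    Literature.NumberTheory.Sieve.DFI1995.gamma0Domain (Finset.univ.image fun q ↦ (g q)⁻¹) ⊆
      (⋃ q, {τ : ℍ | g q • τ ∈ 𝒟ᵒ}) ∪ {τ : ℍ | ∃ s : SL(2, ℤ), s • τ ∈ 𝒟 \ 𝒟ᵒ} := by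
  classical
  rintro τ ⟨t, ht, hτ⟩
  obtain ⟨q, -, rfl⟩ := Finset.mem_image.mp ht
  rw [inv_inv] at hτ
  by_cases ho : g q • τ ∈ 𝒟ᵒ
  · exact Or.inl (mem_iUnion.mpr ⟨q, ho⟩)
  · exact Or.inr ⟨g q, hτ, ho⟩

/-- The Petersson integrand `|f|² y²` (as an `ℝ≥0∞`-valued function) is `Γ₀(N)`-invariant in
weight `2`. [folklore] -/
theorem ofReal_norm_sq_mul_im_sq_smul (f : CuspForm (Gamma0 N) 2) {γ : GL (Fin 2) ℝ}
    (hγ : γ ∈ (Gamma0 N : Subgroup (GL (Fin 2) ℝ))) (τ : ℍ) :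
    ENNReal.ofReal (‖f (γ • τ)‖ ^ 2 * (γ • τ).im ^ 2) = ENNReal.ofReal (‖f τ‖ ^ 2 * τ.im ^ 2) := by
  have h := SlashInvariantFormClass.petersson_smul (k := 2) (f := f) (f' := f) (τ := τ) hγ
  rw [petersson_self_eq_ofReal, petersson_self_eq_ofReal, Complex.ofReal_inj] at h
  have e : ∀ σ : ℍ, σ.im ^ (2 : ℤ) = σ.im ^ 2 := fun σ ↦ zpow_ofNat σ.im 2
  rw [e, e] at h
  rw [h]

/-- **The strip integral is at most the Petersson norm** (`N ≥ 1`, `N Y ≥ 1`): for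
`f ∈ S₂(Γ₀(N))`, `∫_{0<x<1, y>Y} |f(x+iy)|² y² dμ ≤ (f, f)_{Γ₀(N)}`, because the strip meets
every `Γ₀(N)`-orbit at most once up to `±1` (`tsum_indicator_strip_le_two`) while `(f, f)` is
the integral of the `Γ₀(N)`-invariant `|f|² y²` over a fundamental domain
(`peterssonProduct_self_eq_lintegral`, `DFI1995.setLIntegral_le_of_invariant`). This is the
injectivity-of-the-Siegel-strip step of the trivial lower bound in Pasten 2024, §3.
[cite: PastenShimura2024, §3] -/
theorem lintegral_strip_le_peterssonProduct [NeZero N] {Y : ℝ} (hNY : 1 ≤ N * Y)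
    (f : CuspForm (Gamma0 N) 2) :
    ∫⁻ τ in {τ : ℍ | 0 < τ.re ∧ τ.re < 1 ∧ Y < τ.im}, ENNReal.ofReal (‖f τ‖ ^ 2 * τ.im ^ 2) ≤
      ENNReal.ofReal (peterssonProduct (Gamma0 N) 2 f f).re := by
  classical
  letI := Fintype.ofFinite (↥𝒮ℒ ⧸ (Gamma0 N : Subgroup (GL (Fin 2) ℝ)).subgroupOf 𝒮ℒ)
  obtain ⟨g, hg⟩ := exists_mapGL_eq_out (N := N)
  set G : ℍ → ℝ≥0∞ := fun τ ↦ ENNReal.ofReal (‖f τ‖ ^ 2 * τ.im ^ 2) with hGdef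
  have hGm : Measurable G :=
    (((ModularFormClass.continuous f).norm.pow 2).mul (continuous_im.pow 2)).measurable.ennreal_ofReal
  -- the Petersson norm as the integral of `G` over the open domain `F = ⋃_q g_q⁻¹ 𝒟ᵒ`
  have hP := peterssonProduct_self_eq_lintegral g hg f
  rw [lintegral_fd_sum_eq_lintegral_domain g hg f] at hP
  have hre : (peterssonProduct (Gamma0 N) 2 f f).re =
      (∫⁻ τ in ⋃ q, {τ : ℍ | g q • τ ∈ 𝒟ᵒ}, G τ).toReal := by
    rw [hP, Complex.ofReal_re]
  -- finiteness of that integral (integrability of the Petersson integrand on `𝒟`)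
  have hfin : ∫⁻ τ in ⋃ q, {τ : ℍ | g q • τ ∈ 𝒟ᵒ}, G τ ≠ ∞ := by
    rw [← lintegral_fd_sum_eq_lintegral_domain g hg f]
    have hint : IntegrableOn (fun τ : ℍ ↦ ∑ q : (↥𝒮ℒ ⧸ (Gamma0 N : Subgroup (GL (Fin 2) ℝ)).subgroupOf 𝒮ℒ),
        ‖f ((g q)⁻¹ • τ)‖ ^ 2 * ((g q)⁻¹ • τ).im ^ 2) 𝒟 := by
      refine integrable_finsetSum _ fun q _ ↦ ?_
      have hq : IntegrableOn (fun τ : ℍ ↦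
          ‖petersson 2 ⇑f ⇑f (((q.out : ↥𝒮ℒ) : GL (Fin 2) ℝ)⁻¹ • τ)‖) 𝒟 :=
        (integrableOn_petersson_comp_smul_fd 2 f f (q.out).2).norm
      refine IntegrableOn.congr_fun hq (fun τ _ ↦ ?_) isClosed_fd.measurableSet
      have hsm : ((q.out : ↥𝒮ℒ) : GL (Fin 2) ℝ)⁻¹ • τ = (g q)⁻¹ • τ := by
        rw [← hg q, ← map_inv]; rfl
      rw [hsm, petersson_self_eq_ofReal, Complex.norm_real, Real.norm_of_nonneg (by positivity),
        zpow_ofNat]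
    have hlt := hint.lintegral_lt_top
    rw [← lt_top_iff_ne_top]
    convert hlt using 1
    refine lintegral_congr fun τ ↦ ?_
    exact (ENNReal.ofReal_sum_of_nonneg fun q _ ↦ by positivity).symm
  -- the strip integral is at most the integral over the closed domain `⋃_q g_q⁻¹ 𝒟`
  set T : Finset SL(2, ℤ) := Finset.univ.image fun q ↦ (g q)⁻¹ with hT
  have hK : MeasurableSet {τ : ℍ | 0 < τ.re ∧ τ.re < 1 ∧ Y < τ.im} :=
    (measurableSet_lt measurable_const continuous_re.measurable).inter
      ((measurableSet_lt continuous_re.measurable measurable_const).inter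
        (measurableSet_lt measurable_const continuous_im.measurable))
  have h1 : ∫⁻ τ in {τ : ℍ | 0 < τ.re ∧ τ.re < 1 ∧ Y < τ.im}, G τ ≤
      2 / 2 * ∫⁻ τ in Literature.NumberTheory.Sieve.DFI1995.gamma0Domain T, G τ :=
    Literature.NumberTheory.Sieve.DFI1995.setLIntegral_le_of_invariant
      Literature.NumberTheory.Sieve.DFI1995.Gamma0GL_le_range_toGL
      Literature.NumberTheory.Sieve.DFI1995.neg_one_mem_Gamma0GL
      Literature.NumberTheory.Sieve.DFI1995.countable_Gamma0GL
      (Literature.NumberTheory.Sieve.DFI1995.isHypFundamentalDomain_gamma0Domain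
        (isRightTransversal_image_inv g hg))
      hGm (fun γ hγ z ↦ ofReal_norm_sq_mul_im_sq_smul f hγ z) hK
      (fun w ↦ tsum_indicator_strip_le_two hNY w)
  rw [ENNReal.div_self two_ne_zero ENNReal.ofNat_ne_top, one_mul] at h1
  -- and that one is at most the integral over the open domain (they differ by a null set)
  have h2 : ∫⁻ τ in Literature.NumberTheory.Sieve.DFI1995.gamma0Domain T, G τ ≤
      ∫⁻ τ in ⋃ q, {τ : ℍ | g q • τ ∈ 𝒟ᵒ}, G τ := by
    calc ∫⁻ τ in Literature.NumberTheory.Sieve.DFI1995.gamma0Domain T, G τ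
        ≤ ∫⁻ τ in (⋃ q, {τ : ℍ | g q • τ ∈ 𝒟ᵒ}) ∪ {τ : ℍ | ∃ s : SL(2, ℤ), s • τ ∈ 𝒟 \ 𝒟ᵒ}, G τ :=
          lintegral_mono_set (gamma0Domain_subset_iUnion_union g)
      _ ≤ (∫⁻ τ in ⋃ q, {τ : ℍ | g q • τ ∈ 𝒟ᵒ}, G τ) +
            ∫⁻ τ in {τ : ℍ | ∃ s : SL(2, ℤ), s • τ ∈ 𝒟 \ 𝒟ᵒ}, G τ := lintegral_union_le _ _ _
      _ = ∫⁻ τ in ⋃ q, {τ : ℍ | g q • τ ∈ 𝒟ᵒ}, G τ := by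
          rw [setLIntegral_measure_zero _ _ volume_setOf_exists_smul_mem_fd_diff_fdo, add_zero]
  rw [hre, ENNReal.ofReal_toReal hfin]
  exact h1.trans h2

end StripBound




/-! ### One Fourier coefficient against the mean square on a horizontal line -/

section Line

variable {N : ℕ} {k : ℤ}

/-- (Private restatement, in the `ofComplex` form used below, of
`normSq_cuspCoeff_mul_exp_le_intervalIntegral` of `NewformPeterssonSizeProofs.lean`.) For
`f ∈ S_k(Γ₀(N))`, `y > 0` and every `n`, `|aₙ(f)|² e^{-4πny} ≤ ∫₀¹ |f(u + iy)|² du` — from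
`aₙ(f) = ∫₀¹ f(u+iy) e^{-2πin(u+iy)} du` (Mathlib `qExpansion_coeff_eq_intervalIntegral`) and
Jensen's inequality `(∫₀¹ |f|)² ≤ ∫₀¹ |f|²` (Mathlib `ConvexOn.map_set_average_le`). [folklore] -/
private theorem norm_cuspCoeff_sq_mul_exp_le_intervalIntegral (f : CuspForm (Gamma0 N) k) (n : ℕ)
    {y : ℝ} (hy : 0 < y) :
    ‖cuspCoeff f n‖ ^ 2 * Real.exp (-(4 * Real.pi * n * y)) ≤
      ∫ u in (0 : ℝ)..1, ‖f (ofComplex (u + y * Complex.I))‖ ^ 2 := by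
  set F : ℝ → ℝ := fun u ↦ ‖f (ofComplex (u + y * Complex.I))‖ with hF
  have him : ∀ u : ℝ, 0 < (u + y * Complex.I : ℂ).im := fun u ↦ by simpa using hy
  have hFc : Continuous F := by
    have hcont : ContinuousOn (⇑f ∘ ofComplex) {z : ℂ | 0 < z.im} :=
      (UpperHalfPlane.mdifferentiable_iff.mp (ModularFormClass.holo f)).continuousOn
    exact continuous_norm.comp (hcont.comp_continuous (by fun_prop) him)
  have hF0 : ∀ u, 0 ≤ F u := fun u ↦ norm_nonneg _
  -- `aₙ = ∫₀¹ 𝕢(u+iy)⁻ⁿ f(u+iy) du`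
  haveI : Fact (IsCusp OnePoint.infty (Gamma0 N : Subgroup (GL (Fin 2) ℝ))) :=
    ⟨(Gamma0 N : Subgroup (GL (Fin 2) ℝ)).isCusp_of_mem_strictPeriods one_pos (by simp)⟩
  have hcoef := qExpansion_coeff_eq_intervalIntegral (f := ⇑f) one_pos
    (SlashInvariantFormClass.periodic_comp_ofComplex f (by simp)) (ModularFormClass.holo f)
    (ModularFormClass.bdd_at_infty f) n hy
  have hpt : ∀ u : ℝ, f ⟨u + y * (UpperHalfPlane.I : ℂ), by simpa using hy⟩ =
      f (ofComplex (u + y * Complex.I)) := by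
    intro u
    rw [ofComplex_apply_of_im_pos (him u)]
    rfl
  -- `|aₙ| ≤ e^{2πny} ∫₀¹ |f(u+iy)| du`
  have h1 : ‖cuspCoeff f n‖ ≤ Real.exp (2 * Real.pi * n * y) * ∫ u in (0 : ℝ)..1, F u := by
    rw [cuspCoeff, hcoef, Complex.ofReal_one, div_one, one_mul]
    refine (intervalIntegral.norm_integral_le_integral_norm zero_le_one).trans_eq ?_
    rw [← intervalIntegral.integral_const_mul]
    refine intervalIntegral.integral_congr fun u _ ↦ ?_
    rw [norm_mul, hpt u, norm_div, norm_one, norm_pow, Periodic.norm_qParam]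
    simp only [Complex.add_im, Complex.ofReal_im, Complex.mul_im, Complex.ofReal_re,
      UpperHalfPlane.coe_I, Complex.I_im, mul_one, Complex.I_re, mul_zero, add_zero, zero_add,
      div_one, hF]
    congr 1
    rw [← Real.exp_nat_mul, one_div, ← Real.exp_neg]
    congr 1
    ring
  -- Jensen: `(∫₀¹ F)² ≤ ∫₀¹ F²`
  have h2 : (∫ u in (0 : ℝ)..1, F u) ^ 2 ≤ ∫ u in (0 : ℝ)..1, F u ^ 2 := by
    rw [intervalIntegral.integral_of_le zero_le_one, intervalIntegral.integral_of_le zero_le_one]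
    have hvol : (volume : Measure ℝ).real (Ioc 0 1) = 1 := by
      simp [Measure.real]
    have hJ := ConvexOn.map_set_average_le (μ := (volume : Measure ℝ)) (t := Ioc (0 : ℝ) 1)
      (f := F) (g := fun x : ℝ ↦ x ^ 2) (s := univ) (Even.convexOn_pow even_two)
      (continuous_pow 2).continuousOn isClosed_univ (by simp)
      (by simp) (ae_of_all _ fun _ ↦ mem_univ _) hFc.integrableOn_Ioc
      ((hFc.pow 2).integrableOn_Ioc)
    rwa [setAverage_eq, setAverage_eq, hvol, inv_one, one_smul, one_smul] at hJ
  -- combine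
  have h3 : ‖cuspCoeff f n‖ * Real.exp (-(2 * Real.pi * n * y)) ≤ ∫ u in (0 : ℝ)..1, F u := by
    rw [Real.exp_neg, ← div_eq_mul_inv, div_le_iff₀ (Real.exp_pos _), mul_comm]
    exact h1
  have h4 : (‖cuspCoeff f n‖ * Real.exp (-(2 * Real.pi * n * y))) ^ 2 ≤
      (∫ u in (0 : ℝ)..1, F u) ^ 2 :=
    pow_le_pow_left₀ (by positivity) h3 2
  calc ‖cuspCoeff f n‖ ^ 2 * Real.exp (-(4 * Real.pi * n * y))
      = (‖cuspCoeff f n‖ * Real.exp (-(2 * Real.pi * n * y))) ^ 2 := by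
        rw [mul_pow, ← Real.exp_nat_mul]
        congr 2
        push_cast
        ring
    _ ≤ (∫ u in (0 : ℝ)..1, F u) ^ 2 := h4
    _ ≤ ∫ u in (0 : ℝ)..1, F u ^ 2 := h2

end Line

/-! ### Assembly: a single Fourier coefficient against the Petersson norm -/

section Assembly

variable {N : ℕ}

/-- The Petersson norm `(f, f)_{Γ₀(N)}` has non-negative real part (it is the integral of
`|f|² y²`, `peterssonProduct_self_eq_lintegral`). [folklore] -/
theorem peterssonProduct_self_re_nonneg [NeZero N] (f : CuspForm (Gamma0 N) 2) :
    0 ≤ (peterssonProduct (Gamma0 N) 2 f f).re := by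
  classical
  letI := Fintype.ofFinite (↥𝒮ℒ ⧸ (Gamma0 N : Subgroup (GL (Fin 2) ℝ)).subgroupOf 𝒮ℒ)
  obtain ⟨g, hg⟩ := exists_mapGL_eq_out (N := N)
  rw [peterssonProduct_self_eq_lintegral g hg f, Complex.ofReal_re]
  exact ENNReal.toReal_nonneg

/-- **One Fourier coefficient against the Petersson norm.** For `f ∈ S₂(Γ₀(N))`, `N ≥ 1`,
`n ≥ 1` and `N Y ≥ 1`:  `|aₙ(f)|² · e^{-4πnY} / (4πn) ≤ (f, f)_{Γ₀(N)}`. Proof: the strip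
`{0 < x < 1, y > Y}` injects into `Γ₀(N)∖ℍ` up to `±1` (`lintegral_strip_le_peterssonProduct`),
on it `|f|² y² dμ = |f|² dx dy`, and `∫₀¹ |f(x+iy)|² dx ≥ |aₙ|² e^{-4πny}`
(`norm_cuspCoeff_sq_mul_exp_le_intervalIntegral`), `∫_Y^∞ e^{-4πny} dy = e^{-4πnY}/(4πn)`.
This is the `n`-th term of the trivial bound `‖f‖² ≥ ∑ |aₙ|² e^{-4πn}/(4πn)` of Pasten 2024, §3
(there with `Y = 1`). [cite: PastenShimura2024, §3] -/
theorem norm_cuspCoeff_sq_mul_le_peterssonProduct [NeZero N] (f : CuspForm (Gamma0 N) 2) {n : ℕ}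
    (hn : 0 < n) {Y : ℝ} (hNY : 1 ≤ N * Y) :
    ‖cuspCoeff f n‖ ^ 2 * (Real.exp (-(4 * Real.pi * n * Y)) / (4 * Real.pi * n)) ≤
      (peterssonProduct (Gamma0 N) 2 f f).re := by
  have hY : 0 < Y := by
    by_contra hY
    rw [not_lt] at hY
    have : (N : ℝ) * Y ≤ 0 := mul_nonpos_of_nonneg_of_nonpos (Nat.cast_nonneg N) hY
    linarith
  set K : Set ℍ := {τ : ℍ | 0 < τ.re ∧ τ.re < 1 ∧ Y < τ.im} with hKdef
  have hK : MeasurableSet K :=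
    (measurableSet_lt measurable_const continuous_re.measurable).inter
      ((measurableSet_lt continuous_re.measurable measurable_const).inter
        (measurableSet_lt measurable_const continuous_im.measurable))
  set H : ℂ → ℝ≥0∞ := fun z ↦ ENNReal.ofReal (‖f (ofComplex z)‖ ^ 2) with hHdef
  -- Step 1: the strip bound, moved to `ℂ`
  have h1 : ∫⁻ z in ((↑) : ℍ → ℂ) '' K, H z ≤
      ENNReal.ofReal (peterssonProduct (Gamma0 N) 2 f f).re := by
    rw [← lintegral_domain_eq_lintegral_image hK f]
    exact lintegral_strip_le_peterssonProduct hNY f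
  -- Step 2: the image of the strip is the preimage of a product set under `ℂ ≃ ℝ × ℝ`
  set e := Complex.measurableEquivRealProd with he
  have hpre : ((↑) : ℍ → ℂ) '' K = e ⁻¹' (Ioo (0 : ℝ) 1 ×ˢ Ioi Y) := by
    ext z
    simp only [mem_image, mem_preimage, he, Complex.measurableEquivRealProd_apply, mem_prod,
      mem_Ioo, mem_Ioi, hKdef, mem_setOf_eq]
    constructor
    · rintro ⟨τ, ⟨h1, h2, h3⟩, rfl⟩
      exact ⟨⟨h1, h2⟩, h3⟩
    · rintro ⟨⟨h1, h2⟩, h3⟩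
      exact ⟨⟨z, hY.trans h3⟩, ⟨h1, h2, h3⟩, rfl⟩
  -- Step 3: change of variables to `ℝ × ℝ` and Tonelli
  have h3 : ∫⁻ z in ((↑) : ℍ → ℂ) '' K, H z =
      ∫⁻ y in Ioi Y, ∫⁻ x in Ioo (0 : ℝ) 1, H (e.symm (x, y)) := by
    rw [hpre]
    have hcv := Complex.volume_preserving_equiv_real_prod.setLIntegral_comp_preimage_emb
      e.measurableEmbedding (fun p ↦ H (e.symm p)) (Ioo (0 : ℝ) 1 ×ˢ Ioi Y)
    simp only [he, MeasurableEquiv.symm_apply_apply] at hcv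
    rw [he, hcv, Measure.volume_eq_prod, ← Measure.prod_restrict]
    refine lintegral_prod_symm _ ?_
    rw [Measure.prod_restrict, ← Measure.volume_eq_prod]
    refine ContinuousOn.aemeasurable ?_ (measurableSet_Ioo.prod measurableSet_Ioi)
    have hcont : ContinuousOn (⇑f ∘ ofComplex) {z : ℂ | 0 < z.im} :=
      (UpperHalfPlane.mdifferentiable_iff.mp (ModularFormClass.holo f)).continuousOn
    have hsymm : Continuous (Complex.measurableEquivRealProd.symm : ℝ × ℝ → ℂ) :=
      Complex.equivRealProdCLM.symm.continuous
    refine ((ENNReal.continuous_ofReal.comp (continuous_pow 2)).comp_continuousOn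
      (continuous_norm.comp_continuousOn (hcont.comp hsymm.continuousOn ?_)))
    rintro ⟨x, y⟩ ⟨-, hy⟩
    exact hY.trans hy
  -- Step 4: the inner integral on the line `im = y`
  have h4 : ∀ y ∈ Ioi Y, ENNReal.ofReal (‖cuspCoeff f n‖ ^ 2 * Real.exp (-(4 * Real.pi * n * y))) ≤
      ∫⁻ x in Ioo (0 : ℝ) 1, H (e.symm (x, y)) := by
    intro y hy
    have hy0 : 0 < y := hY.trans hy
    have hFc : Continuous fun u : ℝ ↦ ‖f (ofComplex (u + y * Complex.I))‖ ^ 2 := by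
      have hcont : ContinuousOn (⇑f ∘ ofComplex) {z : ℂ | 0 < z.im} :=
        (UpperHalfPlane.mdifferentiable_iff.mp (ModularFormClass.holo f)).continuousOn
      exact (continuous_norm.comp (hcont.comp_continuous (by fun_prop)
        (fun u ↦ by simpa using hy0))).pow 2
    have heq : ∀ x : ℝ, H (e.symm (x, y)) =
        ENNReal.ofReal (‖f (ofComplex (x + y * Complex.I))‖ ^ 2) := by
      intro x
      simp only [hHdef, he, Complex.measurableEquivRealProd_symm_apply, Complex.mk_eq_add_mul_I]
    simp_rw [heq]
    rw [← ofReal_integral_eq_lintegral_ofReal (hFc.integrableOn_Icc.mono_set Ioo_subset_Icc_self)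
      (ae_of_all _ fun x ↦ by positivity), ← integral_Ioc_eq_integral_Ioo,
      ← intervalIntegral.integral_of_le zero_le_one]
    exact ENNReal.ofReal_le_ofReal (norm_cuspCoeff_sq_mul_exp_le_intervalIntegral f n hy0)
  -- Step 5: integrate in `y`
  have h5 : ∫⁻ y in Ioi Y, ENNReal.ofReal (‖cuspCoeff f n‖ ^ 2 * Real.exp (-(4 * Real.pi * n * y))) =
      ENNReal.ofReal (‖cuspCoeff f n‖ ^ 2 * (Real.exp (-(4 * Real.pi * n * Y)) / (4 * Real.pi * n))) := by
    have ha : -(4 * Real.pi * n) < 0 := by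
      have : (0 : ℝ) < n := by exact_mod_cast hn
      nlinarith [Real.pi_pos]
    have hint : IntegrableOn (fun y : ℝ ↦ ‖cuspCoeff f n‖ ^ 2 * Real.exp (-(4 * Real.pi * n) * y))
        (Ioi Y) := (integrableOn_exp_mul_Ioi ha Y).const_mul _
    have heq : ∀ y : ℝ, Real.exp (-(4 * Real.pi * n * y)) = Real.exp (-(4 * Real.pi * n) * y) :=
      fun y ↦ by ring_nf
    simp_rw [heq]
    rw [← ofReal_integral_eq_lintegral_ofReal hint (ae_of_all _ fun y ↦ by positivity),
      integral_const_mul, integral_exp_mul_Ioi ha]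
    congr 2
    field_simp
  -- Step 6: assemble
  have h6 : ENNReal.ofReal (‖cuspCoeff f n‖ ^ 2 * (Real.exp (-(4 * Real.pi * n * Y)) / (4 * Real.pi * n))) ≤
      ENNReal.ofReal (peterssonProduct (Gamma0 N) 2 f f).re := by
    rw [← h5]
    refine (setLIntegral_mono' measurableSet_Ioi h4).trans ?_
    rw [← h3]
    exact h1
  exact (ENNReal.ofReal_le_ofReal_iff (peterssonProduct_self_re_nonneg f)).mp h6

end Assembly


/-! ### Consequences: the level-sharpened trivial bound -/

section Consequences

variable {N : ℕ}

/-- The case `Y = 1/N`: `|aₙ(f)|² e^{-4πn/N}/(4πn) ≤ (f, f)_{Γ₀(N)}` for `f ∈ S₂(Γ₀(N))`, `n ≥ 1`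
(compare `normSq_cuspCoeff_mul_le_peterssonProduct_re` of `NewformPeterssonSizeProofs.lean`,
the case `Y = 1`).
[cite: PastenShimura2024, §3] -/
theorem norm_cuspCoeff_sq_mul_le_peterssonProduct_level [NeZero N] (f : CuspForm (Gamma0 N) 2)
    {n : ℕ} (hn : 0 < n) :
    ‖cuspCoeff f n‖ ^ 2 * (Real.exp (-(4 * Real.pi * n / N)) / (4 * Real.pi * n)) ≤
      (peterssonProduct (Gamma0 N) 2 f f).re := by
  have hN : (0 : ℝ) < N := by exact_mod_cast NeZero.pos N
  have h := norm_cuspCoeff_sq_mul_le_peterssonProduct f hn (Y := 1 / N)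
    (by rw [mul_one_div_cancel hN.ne'])
  convert h using 4
  ring

/-- Pasten's trivial lower bound sharpened to the Siegel strip of height `1/N`: for a *normalised*
cusp form `f ∈ S₂(Γ₀(N))` (`a₁(f) = 1`), `e^{-4π/N}/(4π) ≤ (f, f)_{Γ₀(N)}`
(`peterssonProduct_re_ge_of_isNormalized` of `NewformPeterssonSizeProofs.lean` is the weaker
`e^{-4π}/(4π) ≤ (f, f)`).
[cite: PastenShimura2024, §3] -/
theorem exp_div_le_peterssonProduct_of_isNormalized [NeZero N] {f : CuspForm (Gamma0 N) 2}
    (hf : IsNormalized f) :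
    Real.exp (-(4 * Real.pi / N)) / (4 * Real.pi) ≤ (peterssonProduct (Gamma0 N) 2 f f).re := by
  have h := norm_cuspCoeff_sq_mul_le_peterssonProduct_level f one_pos
  rw [(isNormalized_iff_cuspCoeff_one f).mp hf] at h
  simpa using h

/-- For the newform `f` of an elliptic curve over `ℚ` at level `N`: `e^{-4π/N}/(4π) ≤ (f, f)`.
[cite: PastenShimura2024, §3] -/
theorem IsNewformOf.exp_div_le_peterssonProduct [NeZero N] {W : WeierstrassCurve ℚ}
    {f : CuspForm (Gamma0 N) 2} (h : IsNewformOf W f) :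
    Real.exp (-(4 * Real.pi / N)) / (4 * Real.pi) ≤ (peterssonProduct (Gamma0 N) 2 f f).re :=
  exp_div_le_peterssonProduct_of_isNormalized h.1.2.2

end Consequences

end Literature.NumberTheory.EllipticCurves.ModularForms

end
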